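import Summits.QuantumAdvantage.QuantumAdvantage.Theorems.CharDialTransferDialA
import Summits.QuantumAdvantage.QuantumAdvantage.Theorems.CharDialPlaneDivAscentA
import HarnessLib

/-!
# TransferDial B — THE FIELD HALF: shadow polynomial, plane sums by degree, field core, period functionals

`PlaneDivIn` / `CylRankLe` (verbatim lens-6 g21 «AscentDial», over the tree's `PlaneDiv.planeCount` / `PlaneDiv.perIn`).
`planeDiv_of_poly`: the support of a Boolean function on `𝔽_p^r` agreeing with a polynomial of total degree `≤ 2p − 3` is
plane-divisible (tree `FrobPlane.sum_eval_eq_zero` pulled back along the degree-`≤ 1` plane substitution `plSub`).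
`functionals_of_cyl`: a period space of codimension `≤ K` yields `K` linear functionals deciding membership.
`field_core`: given the field-core constant `K` (hypothesis `hPF : ∀ n W S, PlaneDivIn W S → CylRankLe W S K`), a cut of degree
`≤ 2p − 3` symmetric inside every block (blocks `≥ 3p − 1`) is, on each free-pattern fibre, a function of `K` linear functionals of
the residue vector `(wt_{X_j} mod p)_j` — the lens-6 g8 interpolation engine `SubChar.mBlock_frob` run one notch up (degree `2p − 3`).

Tree twin, part B of 5, of the decomp-qadv lens-6 g23 node «TransferDial» (`Theses/TransferDial.lean` rev 3, sha256
1b7fda5a…95ba; declaration bodies copied verbatim, namespace `…Theses.TransferDial` ↦ `…Theorems.TransferDial`).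
Residual mode beneath `Theses.CharDial.FrobLiftOdd` (stmt 32599): the target `StructureLawTwoOdd` = lens-6 g20 piece B.
0 sorry; no `instance`, no `notation`, no `native_decide`.
-/

set_option autoImplicit false
set_option linter.dupNamespace false

namespace Summit.QuantumAdvantage.QuantumAdvantage.Theorems.TransferDial

open Classical
open Finset Module
open Summit.QuantumAdvantage.AdviceFreeQNC0
open Literature.Computability.MetaComplexity Literature.Computability.MetaComplexity.Smolensky

section Field
variable {p : ℕ} [Fact p.Prime] {n : ℕ}

/-- VERBATIM g21 `Theses.AscentDial.PlaneDivIn`, over the tree twin `PlaneDiv.planeCount` (`Theorems.CharDialPlaneDivAscentA`):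
`S ⊆ W` and every parametrised affine plane of `W` meets `S` in `≡ 0 (mod p)` points. -/
def PlaneDivIn (W : Submodule (ZMod p) (Fin n → ZMod p)) (S : Finset (Fin n → ZMod p)) : Prop :=
  (∀ x ∈ S, x ∈ W) ∧ ∀ x ∈ W, ∀ a ∈ W, ∀ b ∈ W, p ∣ PlaneDiv.planeCount S x a b

/-- VERBATIM g21 `Theses.AscentDial.CylRankLe`, over the tree twin `PlaneDiv.perIn`: `S` is a cylinder over `≤ K` coordinates of `W`. -/
def CylRankLe (W : Submodule (ZMod p) (Fin n → ZMod p)) (S : Finset (Fin n → ZMod p)) (K : ℕ) : Prop :=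
  finrank (ZMod p) W ≤ finrank (ZMod p) (PlaneDiv.perIn W S) + K

end Field


/-! ## §5 Kernel: THE FIELD HALF — shadow polynomial, plane sums by degree, PF, period functionals -/

section FieldHalf
variable {p : ℕ} [hp : Fact p.Prime]
open SubChar SubLog FrobPlane MvPolynomial

/-- The union of the blocks is the set of non-free coordinates. -/
theorem mem_blockUnion_blockOf {m r : ℕ} (b : Fin m → Option (Fin r)) (i : Fin m) :
    i ∈ blockUnion (blockOf b) ↔ b i ≠ none := by
  unfold blockUnion
  rw [mem_biUnion]
  constructor
  · rintro ⟨j, -, hj⟩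
    rw [mem_blockOf] at hj
    simp [hj]
  · intro h
    obtain ⟨j, hj⟩ := Option.ne_none_iff_exists'.1 h
    exact ⟨j, mem_univ _, (mem_blockOf b j i).2 hj⟩

/-- Distinct blocks are disjoint. -/
theorem blockOf_disjoint {m r : ℕ} (b : Fin m → Option (Fin r)) :
    ∀ j k : Fin r, j ≠ k → Disjoint (blockOf b j) (blockOf b k) := by
  intro j k hjk
  rw [Finset.disjoint_left]
  intro i hi hi'
  rw [mem_blockOf] at hi hi'
  exact hjk (Option.some.inj (hi.symm.trans hi'))

/-- Substitution of a parametrised affine plane `x + s•a + t•c` of `𝔽_p^r` (polynomials of degree `≤ 1` in `s, t`). -/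
noncomputable def plSub {r : ℕ} (x a c : Fin r → ZMod p) : Fin r → MvPolynomial (Fin 2) (ZMod p) :=
  fun i => C (x i) + C (a i) * X 0 + C (c i) * X 1

/-- The plane substitution has total degree `≤ 1` in each coordinate. -/
theorem plSub_deg {r : ℕ} (x a c : Fin r → ZMod p) (i : Fin r) : (plSub x a c i).totalDegree ≤ 1 := by
  unfold plSub
  refine (totalDegree_add _ _).trans (max_le ((totalDegree_add _ _).trans (max_le ?_ ?_)) ?_)
  · simp [totalDegree_C]
  · refine (totalDegree_mul _ _).trans ?_; simp [totalDegree_C, totalDegree_X]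
  · refine (totalDegree_mul _ _).trans ?_; simp [totalDegree_C, totalDegree_X]

/-- Evaluating the plane substitution at `(s,t)` gives the plane point `x + s•a + t•c`. -/
theorem eval_plSub {r : ℕ} (x a c : Fin r → ZMod p) (y : Fin 2 → ZMod p) :
    (fun i => eval y (plSub x a c i)) = x + y 0 • a + y 1 • c := by
  funext i
  simp [plSub, mul_comm]

/-- PLANE SUMS BY DEGREE: the support of a Boolean function on `𝔽_p^r` that agrees with a polynomial of total degree
`≤ 2p − 3` meets every parametrised affine plane in `≡ 0 (mod p)` points (tree `FrobPlane.sum_eval_eq_zero` on the plane,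
pulled back along the degree-`≤ 1` substitution `plSub`). -/
theorem planeDiv_of_poly {r : ℕ} (G : (Fin r → ZMod p) → Bool) (P : MvPolynomial (Fin r) (ZMod p))
    (hdeg : P.totalDegree ≤ 2 * p - 3) (hP : ∀ x, eval x P = if G x then 1 else 0) :
    ∀ x a c : Fin r → ZMod p, p ∣ PlaneDiv.planeCount (univ.filter fun y => G y = true) x a c := by
  intro x a c
  rw [← ZMod.natCast_eq_zero_iff]
  unfold PlaneDiv.planeCount
  rw [Finset.natCast_card_filter]
  have h1 : ∀ st : ZMod p × ZMod p,
      (if x + st.1 • a + st.2 • c ∈ univ.filter (fun y => G y = true) then (1 : ZMod p) else 0)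
        = eval (x + st.1 • a + st.2 • c) P := by
    intro st
    rw [hP]
    simp only [mem_filter, mem_univ, true_and]
  rw [Finset.sum_congr rfl fun st _ => h1 st]
  have h2 : ∑ st : ZMod p × ZMod p, eval (x + st.1 • a + st.2 • c) P
      = ∑ y : Fin 2 → ZMod p, eval y (bind₁ (plSub x a c) P) := by
    refine Fintype.sum_equiv (finTwoArrowEquiv (ZMod p)).symm _ _ fun st => ?_
    rw [eval_bind₁, eval_plSub]
    simp
  rw [h2]
  exact sum_eval_eq_zero _ ((totalDegree_bind₁_le_of_le_one _ (plSub_deg x a c) P).trans hdeg)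

/-- PERIOD FUNCTIONALS: if the period space of `S ⊆ 𝔽_p^r` has codimension `≤ K`, membership in `S` is decided by `K`
linear functionals (coordinates of the quotient map by the period space, padded with zeros). -/
theorem functionals_of_cyl {r K : ℕ} (S : Finset (Fin r → ZMod p))
    (h : finrank (ZMod p) (⊤ : Submodule (ZMod p) (Fin r → ZMod p)) ≤ finrank (ZMod p) (PlaneDiv.perIn ⊤ S) + K) :
    ∃ φ : Fin K → ((Fin r → ZMod p) →ₗ[ZMod p] ZMod p),
      ∀ x y : Fin r → ZMod p, (∀ k, φ k x = φ k y) → (x ∈ S ↔ y ∈ S) := by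
  set Per := PlaneDiv.perIn (⊤ : Submodule (ZMod p) (Fin r → ZMod p)) S with hPer
  have hd : finrank (ZMod p) ((Fin r → ZMod p) ⧸ Per) ≤ K := by
    have h1 := Submodule.finrank_quotient_add_finrank Per
    rw [finrank_top, Module.finrank_fin_fun] at h
    rw [Module.finrank_fin_fun] at h1
    omega
  let bQ := Module.finBasis (ZMod p) ((Fin r → ZMod p) ⧸ Per)
  let full : (Fin r → ZMod p) →ₗ[ZMod p] (Fin (finrank (ZMod p) ((Fin r → ZMod p) ⧸ Per)) → ZMod p) :=
    bQ.equivFun.toLinearMap.comp Per.mkQ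
  refine ⟨fun k => if hk : (k : ℕ) < finrank (ZMod p) ((Fin r → ZMod p) ⧸ Per)
      then (LinearMap.proj (⟨k, hk⟩ : Fin _)).comp full else 0, fun x y hxy => ?_⟩
  have hfull : full x = full y := by
    funext i
    have := hxy ⟨i, lt_of_lt_of_le i.2 hd⟩
    simp only [dif_pos i.2, LinearMap.comp_apply, LinearMap.proj_apply] at this
    exact this
  have hq : Per.mkQ x = Per.mkQ y := bQ.equivFun.injective hfull
  rw [Submodule.mkQ_apply, Submodule.mkQ_apply, Submodule.Quotient.eq] at hq
  have hper := (PlaneDiv.mem_perIn.1 hq).2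
  rw [hper y, add_sub_cancel]

/-- ★★★ KERNEL — THE FIELD HALF OF THE TRANSFER (NODE §2 (T4)–(T6)), for ONE assignment of the free coordinates.
Given the field core PF with constant `K` (for this `p`), a cut of degree `≤ 2p − 3` that is symmetric in the blocks
of a block map (all blocks `≥ 3p − 1`) is, on each free-coordinate fibre, a function of `K` LINEAR FUNCTIONALS of the
block-residue vector `(wt_{X_j}(u) mod p)_j ∈ 𝔽_p^r`.  Chain: cube shadow (`shadow_blocks`, §4) ⟹ Möbius/binomial
interpolation of the residue profile by a polynomial of total degree `≤ 2p − 3` on `𝔽_p^r` (tree `SubChar.moeb_mBlock`,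
`sum_powerset_mBlock`, `FrobPlane.binomPm`, the lens-6 g8 `mBlock_frob` engine one notch up) ⟹ plane sums
(`planeDiv_of_poly`) ⟹ PF ⟹ period functionals (`functionals_of_cyl`). -/
theorem field_core (hp3 : 3 ≤ p) (K : ℕ)
    (hPF : ∀ (n : ℕ) (W : Submodule (ZMod p) (Fin n → ZMod p)) (S : Finset (Fin n → ZMod p)),
      PlaneDivIn W S → CylRankLe W S K)
    {m r : ℕ} {f : (Fin m → Bool) → Bool} (hf : HasDegF p f (2 * p - 3)) (b : Fin m → Option (Fin r))
    (hsw : ∀ i k, b i = b k → b i ≠ none → ∀ u : Fin m → Bool, f (u ∘ Equiv.swap i k) = f u)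
    (hbig : ∀ j : Fin r, 3 * p - 1 ≤ (blockOf b j).card) (z : Fin m → Bool) :
    ∃ φ : Fin K → ((Fin r → ZMod p) →ₗ[ZMod p] ZMod p), ∃ Fz : (Fin K → ZMod p) → Bool,
      ∀ u : Fin m → Bool, (∀ i, b i = none → u i = z i) →
        f u = Fz (fun k => φ k (fun j => (bw (blockOf b j) u : ZMod p))) := by
  have hp1 : 1 < p := hp.out.one_lt
  have hdis : ∀ j k, j ≠ k → Disjoint (blockOf b j) (blockOf b k) := blockOf_disjoint b
  have hA : ∀ j, p - 1 ≤ (blockOf b j).card := fun j => by have := hbig j; omega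
  let Y : Finset (Fin m) := blockUnion (blockOf b)
  have hY : ∀ i, i ∈ Y ↔ b i ≠ none := mem_blockUnion_blockOf b
  have hAY : ∀ j, blockOf b j ⊆ Y := by
    intro j i hi
    rw [hY]
    rw [mem_blockOf] at hi
    simp [hi]
  -- the frozen cut: free coordinates set to `z`
  let fz : (Fin m → Bool) → Bool := fun u => f (overOn Y z u)
  have hfz : HasDegF p fz (2 * p - 3) := hasDegF_overOn p Y z hf
  have hfz_eq : ∀ u : Fin m → Bool, (∀ i, b i = none → u i = z i) → fz u = f u := by
    intro u hu
    show f (overOn Y z u) = f u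
    congr 1
    funext i
    simp only [overOn]
    by_cases hi : i ∈ Y
    · rw [if_pos hi]
    · rw [if_neg hi, hu i (not_ne_iff.1 ((not_congr (hY i)).1 hi))]
  have hbw_ov : ∀ j (u : Fin m → Bool), bw (blockOf b j) (overOn Y z u) = bw (blockOf b j) u := by
    intro j u
    unfold bw
    congr 1
    refine filter_congr fun i hi => ?_
    simp only [overOn, if_pos (hAY j hi)]
  have hswz : ∀ i k, b i = b k → b i ≠ none → ∀ u : Fin m → Bool, fz (u ∘ Equiv.swap i k) = fz u := by
    intro i k hik hi u
    have hiY : i ∈ Y := (hY i).2 hi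
    have hkY : k ∈ Y := (hY k).2 (hik ▸ hi)
    show f (overOn Y z (u ∘ Equiv.swap i k)) = f (overOn Y z u)
    have e : overOn Y z (u ∘ Equiv.swap i k) = (overOn Y z u) ∘ Equiv.swap i k := by
      funext l
      simp only [overOn, Function.comp]
      by_cases hli : l = i
      · subst hli; rw [Equiv.swap_apply_left, if_pos hiY, if_pos hkY]
      · by_cases hlk : l = k
        · subst hlk; rw [Equiv.swap_apply_right, if_pos hkY, if_pos hiY]
        · rw [Equiv.swap_apply_of_ne_of_ne hli hlk]
    rw [e, hsw i k hik hi]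
  have hbig2 : ∀ i, b i ≠ none → 3 * p - 1 ≤ (univ.filter fun k : Fin m => b k = b i).card := by
    intro i hi
    obtain ⟨j, hj⟩ := Option.ne_none_iff_exists'.1 hi
    rw [hj]
    exact hbig j
  -- KEY (cube shadow, §4): `fz` depends only on the block weights mod `p`
  have hmodz : ∀ u v : Fin m → Bool, (∀ j, bw (blockOf b j) u % p = bw (blockOf b j) v % p) → fz u = fz v := by
    intro u v huv
    have hid : ∀ w : Fin m → Bool, fz w = fz (overOn Y z w) := by
      intro w
      show f (overOn Y z w) = f (overOn Y z (overOn Y z w))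
      congr 1
      funext i
      simp only [overOn]
      by_cases hi : i ∈ Y <;> simp [hi]
    rw [hid u, hid v]
    refine shadow_blocks hp3 hfz b hswz hbig2 _ _ (fun k hk => ?_) (fun j => ?_)
    · have hkY : k ∉ Y := fun h => (hY k).1 h hk
      simp only [overOn, if_neg hkY]
    · rw [hbw_ov, hbw_ov]
      exact huv j
  have hsym : ∀ u v : Fin m → Bool, (∀ j, bw (blockOf b j) u = bw (blockOf b j) v) → fz u = fz v :=
    fun u v h => hmodz u v fun j => by rw [h j]
  -- ===== interpolation (the `mBlock_frob` engine at degree 2p − 3) =====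
  let wv : (Fin m → Bool) → (Fin r → ℕ) := fun u j => bw (blockOf b j) u
  let Φ : (Fin r → ℕ) → Bool := fun w =>
    if h : ∃ u : Fin m → Bool, wv u = w then fz (Classical.choose h) else false
  have hΦ : ∀ u, fz u = Φ (wv u) := by
    intro u
    have h : ∃ v : Fin m → Bool, wv v = wv u := ⟨u, rfl⟩
    simp only [Φ, dif_pos h]
    have hc := Classical.choose_spec h
    exact hsym u _ fun j => (congrFun hc j).symm
  have hreal : ∀ w : Fin r → ℕ, (∀ j, w j ≤ (blockOf b j).card) →
      ∃ T ⊆ blockUnion (blockOf b), ∀ j, (T ∩ blockOf b j).card = w j := fun w hw => exists_realize hdis w hw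
  let g : (Fin m → Bool) → ZMod p := indR (ZMod p) fz
  have hg_mem : g ∈ lowDeg (ZMod p) m (2 * p - 3) := (hasDegF_iff_indR p fz (2 * p - 3)).1 hfz
  let Φh : (Fin r → ℕ) → ZMod p := fun w => if Φ w = true then 1 else 0
  have hwv_vert : ∀ T, wv (vert T) = fun j => (T ∩ blockOf b j).card := by
    intro T; funext j; exact bw_vert (blockOf b j) T
  have hgvert : ∀ T ⊆ blockUnion (blockOf b), g (vert T) = Φh (fun j => (T ∩ blockOf b j).card) := by
    intro T _
    simp only [g, indR, Φh, hΦ (vert T), hwv_vert]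
  have hmoeb : ∀ S ⊆ blockUnion (blockOf b), moeb g S = gamM Φh (fun j => (S ∩ blockOf b j).card) :=
    fun S hS => moeb_mBlock hdis g Φh hgvert hS
  -- γ(i) = 0 when Σ i_j > 2p − 3 (degree test)
  have hgam0 : ∀ i : Fin r → ℕ, (∀ j, i j < p) → 2 * p - 3 < ∑ j, i j → gamM Φh i = 0 := by
    intro i hi hsum
    obtain ⟨S, hS, hSA⟩ := hreal i fun j => by have := hA j; have := hi j; omega
    have hi' : (fun j => (S ∩ blockOf b j).card) = i := funext hSA
    rw [← hi', ← hmoeb S hS]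
    refine moeb_eq_zero_of_mem_lowDeg hg_mem ?_
    rw [card_eq_mBlock hdis hS]
    have : ∑ j, (S ∩ blockOf b j).card = ∑ j, i j := Finset.sum_congr rfl fun j _ => hSA j
    rw [this]; exact hsum
  -- the interpolating polynomial of total degree ≤ 2p − 3
  let box : Finset (Fin r → ℕ) := Fintype.piFinset fun _ => range p
  let idx : Finset (Fin r → ℕ) := box.filter fun i => ∑ j, i j ≤ 2 * p - 3
  let P : MvPolynomial (Fin r) (ZMod p) :=
    ∑ i ∈ idx, MvPolynomial.C (gamM Φh i) * ∏ j, binomPm j (i j)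
  have hdeg : P.totalDegree ≤ 2 * p - 3 := by
    refine (totalDegree_finsetSum _ _).trans (Finset.sup_le fun i hi => ?_)
    have hi' := (mem_filter.1 hi).2
    refine (totalDegree_mul _ _).trans ?_
    rw [totalDegree_C, zero_add]
    refine (totalDegree_finsetProd _ _).trans ?_
    exact (Finset.sum_le_sum fun j _ => totalDegree_binomPm j (i j)).trans hi'
  have hevalP : ∀ x : Fin r → ZMod p, MvPolynomial.eval x P =
      ∑ i ∈ box, (∏ j, (((x j).val.choose (i j) : ℕ) : ZMod p)) * gamM Φh i := by
    intro x
    simp only [P, MvPolynomial.eval_sum, MvPolynomial.eval_mul, MvPolynomial.eval_C, MvPolynomial.eval_prod]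
    rw [Finset.sum_filter]
    refine Finset.sum_congr rfl fun i hi => ?_
    have hi' : ∀ j, i j < p := fun j => mem_range.1 (Fintype.mem_piFinset.1 hi j)
    by_cases hq : ∑ j, i j ≤ 2 * p - 3
    · rw [if_pos hq, mul_comm]
      congr 1
      exact Finset.prod_congr rfl fun j _ => eval_binomPm x j (hi' j)
    · rw [if_neg hq, hgam0 i hi' (by omega), mul_zero]
  have hprof : ∀ w : Fin r → ℕ, (∀ j, w j < p) →
      (if Φ w = true then (1 : ZMod p) else 0) =
        ∑ i ∈ box, (∏ j, (((w j).choose (i j) : ℕ) : ZMod p)) * gamM Φh i := by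
    intro w hw
    obtain ⟨T, hT, hTA⟩ := hreal w fun j => by have := hA j; have := hw j; omega
    have hw' : (fun j => (T ∩ blockOf b j).card) = w := funext hTA
    have h1 : (if Φ w = true then (1 : ZMod p) else 0) = g (vert T) := by
      rw [hgvert T hT, hw']
    rw [h1, ← sum_moeb_powerset g T]
    have h2 : ∑ S ∈ T.powerset, moeb g S = ∑ S ∈ T.powerset, gamM Φh (fun j => (S ∩ blockOf b j).card) :=
      Finset.sum_congr rfl fun S hS => hmoeb S ((mem_powerset.1 hS).trans hT)
    rw [h2, sum_powerset_mBlock hdis hT (gamM Φh)]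
    simp only [hTA]
    have hsub : Fintype.piFinset (fun j => range (w j + 1)) ⊆ box :=
      Fintype.piFinset_subset _ _ fun j => range_subset_range.2 (by have := hw j; omega)
    rw [← Finset.sum_subset hsub]
    · refine Finset.sum_congr rfl fun i _ => ?_
      rw [nsmul_eq_mul, Nat.cast_prod]
    · intro i _ hi
      rw [Fintype.mem_piFinset, not_forall] at hi
      obtain ⟨j, hj⟩ := hi
      rw [mem_range, not_lt] at hj
      have : (((w j).choose (i j) : ℕ) : ZMod p) = 0 := by
        rw [Nat.choose_eq_zero_of_lt (by omega), Nat.cast_zero]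
      rw [Finset.prod_eq_zero (Finset.mem_univ j) this, zero_mul]
  -- the residue profile on 𝔽_p^r and its polynomial
  let G : (Fin r → ZMod p) → Bool := fun x => Φ (fun j => (x j).val)
  have hP : ∀ x, MvPolynomial.eval x P = if G x then 1 else 0 := by
    intro x
    rw [hevalP x]
    exact (hprof (fun j => (x j).val) fun j => ZMod.val_lt _).symm
  -- reduction of the weights mod p (the shadow again)
  have hmod : ∀ w : Fin r → ℕ, (∀ k, w k ≤ (blockOf b k).card) → Φ w = Φ (fun k => w k % p) := by
    intro w hw
    obtain ⟨T, hT, hTA⟩ := hreal w hw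
    obtain ⟨T', hT', hTA'⟩ := hreal (fun k => w k % p) fun k => (Nat.mod_le _ _).trans (hw k)
    have e1 : Φ w = fz (vert T) := by
      rw [hΦ (vert T), hwv_vert T]
      congr 1; funext j; rw [hTA j]
    have e2 : Φ (fun k => w k % p) = fz (vert T') := by
      rw [hΦ (vert T'), hwv_vert T']
      congr 1; funext j; rw [hTA' j]
    rw [e1, e2]
    refine hmodz _ _ fun j => ?_
    rw [bw_vert, bw_vert, hTA j, hTA' j, Nat.mod_mod]
  -- ===== plane sums, PF, period functionals =====
  let S : Finset (Fin r → ZMod p) := univ.filter fun y => G y = true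
  have hdiv := planeDiv_of_poly G P hdeg hP
  have hcyl : CylRankLe ⊤ S K := hPF r ⊤ S ⟨fun x _ => Submodule.mem_top, fun x _ a _ c _ => hdiv x a c⟩
  obtain ⟨φ, hφ⟩ := functionals_of_cyl S hcyl
  let Fz : (Fin K → ZMod p) → Bool := fun vals => decide (∃ y : Fin r → ZMod p, (∀ k, φ k y = vals k) ∧ G y = true)
  have hFz : ∀ x, G x = Fz (fun k => φ k x) := by
    intro x
    by_cases hGx : G x = true
    · rw [hGx]; symm
      simp only [Fz, decide_eq_true_eq]
      exact ⟨x, fun k => rfl, hGx⟩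
    · have hGx' : G x = false := by simpa using hGx
      rw [hGx']; symm
      simp only [Fz, decide_eq_false_iff_not]
      rintro ⟨y, hy, hGy⟩
      have hxS : x ∈ S ↔ y ∈ S := hφ x y fun k => (hy k).symm
      simp only [S, mem_filter, mem_univ, true_and] at hxS
      rw [hGx', hGy] at hxS
      simp at hxS
  refine ⟨φ, Fz, fun u hu => ?_⟩
  let x₀ : Fin r → ZMod p := fun j => (bw (blockOf b j) u : ZMod p)
  have hx : G x₀ = f u := by
    show Φ (fun j => (x₀ j).val) = f u
    rw [← hfz_eq u hu, hΦ u, hmod _ fun k => bw_le (blockOf b k) u]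
    congr 1
    funext j
    simp [x₀, ZMod.val_natCast]
  exact hx.symm.trans (hFz x₀)

end FieldHalf

end Summit.QuantumAdvantage.QuantumAdvantage.Theorems.TransferDial
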